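import Summits.AnomalousDissipation.AnomalousDissipation.Theorems.SawtoothPulseCascadeK1LocalisedCascadePhaseTwoStartBoxStrip
import Summits.AnomalousDissipation.AnomalousDissipation.Theorems.SawtoothPulseCascadeK1LocalisedCascadePhaseTwoStartBoxSeries
import Mathlib.Analysis.Real.Pi.Bounds

/-!
# K1loc, line `Spectral` / thin start — helper: PHASE-TWO START BOX IV — `S_1(12) ≤ 171/20000` and the start box `E_2(800)`

Helper file of the prover lane on the crux `K1LocalisedCascade` (stmt-AnomalousDissipation-19491), route `SawtoothPulseCascade`
(glue seat; start box of record `StartBoxTwo`, arbiter A23-4…A23-10: `j₀ = 2`, `K_2 = 800`, `E_2 ≤ 3/100`).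
* **`phaseOne_strip12_le`**: `γ = 8`, `N₀ = 1`, `0 < δ₀ ≤ 2⁻³⁰` ⇒ `Σ'[|k₀| < 12]‖𝓕a₁‖² ≤ 171/20000 = 0.00855`
  (`…PhaseTwoStartBoxStrip.phaseOne_strip_le_of_series` at `K = 12` with `B = 1/1000` from `…PhaseTwoStartBoxSeries`; `π > 3.1415`).
  In units of `‖datum‖² = ½` this is `0.0171` (truth `0.01415`, lineages A = kit j305210 grid and B = p5's exact comb).
* **`phaseTwo_start_le`** (the box): the phase-1 half-steps enter through THREE NAMED HYPOTHESES in half-step conclusion shape —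
  (hT) `Σ'[|k₁| < K′]‖𝓕b₁‖² ≤ Σ'[|k₀| < 12]‖𝓕a₁‖² + j_H` (H half-step, low fibres of `b₁`),
  (hS) `Σ'[|k₀| < 800]‖𝓕a₂‖² ≤ Σ'[|k₁| < K′]‖𝓕b₁‖² + j_V` (V half-step, strip of `a₂`),
  (hO) `Σ'[800 ≤ |k₀| ∧ |k₀| ≤ 4|k₁|]‖𝓕a₂‖² ≤ j_O` (the closer's off-cone class at `K_2`, slope `(1,4)`) —
  ⇒ **`S_2(800) + O_2(800) ≤ 171/20000 + j_H + j_V + j_O`**.  Truths (lineage B): `j_H ≈ 5.5e-4`, `j_V ≈ 2.4e-5`, `j_O ≈ 1.8e-4`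
  (abs), so `E_2 ≈ 0.0093 abs = 0.019·‖datum‖² ≤ 3/100`; the dischargers of (hT)/(hS)/(hO) are the corner-trace / `L²`
  half-steps at phase 1 (p1 g7 `CornerTraceSum`, then `HalfStepCT`), not in this file.
No definitions; nothing about the crux at `δ₀ = ¼`. [cite: Grafakos2014, Prop. 3.1.2 (5) and Prop. 3.2.7 (3)] [problem: turb]
-/

-- `Summit.<Summit>.<Problem>`: single-conjunct summit, the duplicate namespace segment is deliberate.
set_option linter.dupNamespace false

noncomputable section

namespace Summit.AnomalousDissipation.AnomalousDissipation.Theorems.SawtoothPulseCascade.K1Start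

open MeasureTheory Set Filter Topology UnitAddTorus Function Complex AddCircle
open scoped Real
open Literature.Analysis Literature.Analysis.FunctionSpaces Literature.Analysis.FunctionSpaces.Torus Literature.Analysis.FluidPDE
open Literature.Analysis.FluidPDE.ShearStage
open Literature.Analysis.FluidPDE.SawtoothCascade Literature.Analysis.FluidPDE.SawtoothCascade.CascadeParams

/-! ## §1 The numeric value of the strip bound -/

/-- `(16/(63π) + 2⁻²⁵)² + (2⁻²⁵)²/2 + (√(2/1000) + 2⁻²⁵)² ≤ 171/20000` (`π > 3.1415`). [folklore] -/
theorem strip12_const_le :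
    (16 / (63 * π) + (2 : ℝ)⁻¹ ^ 25) ^ 2 + ((2 : ℝ)⁻¹ ^ 25) ^ 2 / 2 + (Real.sqrt (2 * (1 / 1000)) + (2 : ℝ)⁻¹ ^ 25) ^ 2 ≤
      171 / 20000 := by
  have hπ : 3.1415 < π := Real.pi_gt_d4
  have hπ0 : 0 < π := Real.pi_pos
  -- `16/(63π) ≤ 0.080856`
  have h1 : 16 / (63 * π) ≤ 0.080856 := by
    rw [div_le_iff₀ (by positivity)]; nlinarith
  have h10 : 0 ≤ 16 / (63 * π) := by positivity
  -- `√(2/1000) ≤ 0.044722`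
  have h2 : Real.sqrt (2 * (1 / 1000)) ≤ 0.044722 := by
    rw [Real.sqrt_le_left (by norm_num)]; norm_num
  have h20 : 0 ≤ Real.sqrt (2 * (1 / 1000)) := Real.sqrt_nonneg _
  have hε : ((2 : ℝ)⁻¹ ^ 25) ≤ 0.0000001 := by norm_num
  have hε0 : (0 : ℝ) ≤ (2 : ℝ)⁻¹ ^ 25 := by positivity
  have hA : (16 / (63 * π) + (2 : ℝ)⁻¹ ^ 25) ^ 2 ≤ (0.080856 + 0.0000001) ^ 2 :=
    pow_le_pow_left₀ (by positivity) (add_le_add h1 hε) 2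
  have hB : (Real.sqrt (2 * (1 / 1000)) + (2 : ℝ)⁻¹ ^ 25) ^ 2 ≤ (0.044722 + 0.0000001) ^ 2 :=
    pow_le_pow_left₀ (by positivity) (add_le_add h2 hε) 2
  have hC : ((2 : ℝ)⁻¹ ^ 25) ^ 2 / 2 ≤ (0.0000001 : ℝ) ^ 2 / 2 :=
    div_le_div_of_nonneg_right (pow_le_pow_left₀ hε0 hε 2) (by norm_num)
  have : (0.080856 + 0.0000001 : ℝ) ^ 2 + (0.0000001 : ℝ) ^ 2 / 2 + (0.044722 + 0.0000001) ^ 2 ≤ 171 / 20000 := by norm_num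
  linarith

section Cascade

variable (P : CascadeParams)

/-- **THE STRIP OF `a₁`, CERTIFIED**: `γ = 8`, `N₀ = 1`, `0 < δ₀ ≤ 2⁻³⁰` ⇒ `Σ'[|k₀| < 12]‖𝓕a₁‖² ≤ 171/20000`
(`= 0.0171·‖datum‖²`; truth `0.01415·‖datum‖²`). [cite: Grafakos2014, Prop. 3.1.2 (5) and Prop. 3.2.7 (3)] -/
theorem phaseOne_strip12_le (hγ : P.γ = 8) (hN₀ : P.N₀ = 1) (hδ₀ : 0 < P.δ₀) (hδ₀' : P.δ₀ ≤ (2 : ℝ)⁻¹ ^ 30) (hd : 0 < P.d)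
    (a b : ℕ → UnitAddTorus (Fin 2) → ℝ) (h0 : a 0 = datum)
    (hb : b 0 = a 0 ∘ shearMap 0 1 (amp ⟨P.U 0, P.U_periodic 0, P.contDiff_U (P.δ_pos hδ₀ hd 0)⟩ P.γ))
    (hab : a 1 = b 0 ∘ shearMap 1 0 (amp ⟨P.U 0, P.U_periodic 0, P.contDiff_U (P.δ_pos hδ₀ hd 0)⟩ P.γ)) :
    ∑' k : Fin 2 → ℤ, (if |k 0| < ((12 : ℕ) : ℤ) then (1 : ℝ) else 0) * ‖mFourierCoeff (fun x => (a 1 x : ℂ)) k‖ ^ 2 ≤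
      171 / 20000 := by
  have h := phaseOne_strip_le_of_series P hγ hN₀ hδ₀ hδ₀' hd a b h0 hb hab 12 (B := 1 / 1000)
    (fun ε hε0 hε T => sum_strip12_series_le hε0 hε T)
  exact h.trans strip12_const_le

/-! ## §2 The start box -/

/-- **THE PHASE-TWO START BOX** (`StartBoxTwo`, `K_2 = 800`): with the phase-1 half-steps as named hypotheses —
(hT) the H half-step feeds the low V-fibres `|k₁| < K′` of `b₁` from the strip `|k₀| < 12` of `a₁` up to `j_H`,
(hS) the V half-step feeds the strip `|k₀| < 800` of `a₂` from those low fibres up to `j_V`,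
(hO) the off-cone class of `a₂` at `K_2 = 800` (slope `|k₀| ≤ 4|k₁|`) is at most `j_O` —
`Σ'[|k₀| < 800]‖𝓕a₂‖² + Σ'[800 ≤ |k₀| ∧ |k₀| ≤ 4|k₁|]‖𝓕a₂‖² ≤ 171/20000 + j_H + j_V + j_O`.
(Lineage-B truths: `j_H ≈ 5.5·10⁻⁴`, `j_V ≈ 2.4·10⁻⁵`, `j_O ≈ 1.8·10⁻⁴` ⇒ `E_2 ≈ 0.0093 = 0.019·‖datum‖²`.)
[cite: Grafakos2014, Prop. 3.1.2 (5) and Prop. 3.2.7 (3)] -/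
theorem phaseTwo_start_le (hγ : P.γ = 8) (hN₀ : P.N₀ = 1) (hδ₀ : 0 < P.δ₀) (hδ₀' : P.δ₀ ≤ (2 : ℝ)⁻¹ ^ 30) (hd : 0 < P.d)
    (a b : ℕ → UnitAddTorus (Fin 2) → ℝ) (h0 : a 0 = datum)
    (hb : ∀ j, b j = a j ∘ shearMap 0 1 (amp ⟨P.U j, P.U_periodic j, P.contDiff_U (P.δ_pos hδ₀ hd j)⟩ P.γ))
    (hab : ∀ j, a (j + 1) = b j ∘ shearMap 1 0 (amp ⟨P.U j, P.U_periodic j, P.contDiff_U (P.δ_pos hδ₀ hd j)⟩ P.γ))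
    (K' : ℕ) {jH jV jO : ℝ}
    (hT : ∑' k : Fin 2 → ℤ, (if |k 1| < (K' : ℤ) then (1 : ℝ) else 0) * ‖mFourierCoeff (fun x => (b 1 x : ℂ)) k‖ ^ 2 ≤
      ∑' k : Fin 2 → ℤ, (if |k 0| < ((12 : ℕ) : ℤ) then (1 : ℝ) else 0) * ‖mFourierCoeff (fun x => (a 1 x : ℂ)) k‖ ^ 2 + jH)
    (hS : ∑' k : Fin 2 → ℤ, (if |k 0| < ((800 : ℕ) : ℤ) then (1 : ℝ) else 0) * ‖mFourierCoeff (fun x => (a 2 x : ℂ)) k‖ ^ 2 ≤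
      ∑' k : Fin 2 → ℤ, (if |k 1| < (K' : ℤ) then (1 : ℝ) else 0) * ‖mFourierCoeff (fun x => (b 1 x : ℂ)) k‖ ^ 2 + jV)
    (hO : ∑' k : Fin 2 → ℤ, (if ((800 : ℕ) : ℤ) ≤ |k 0| ∧ ((1 : ℕ) : ℤ) * |k 0| ≤ ((4 : ℕ) : ℤ) * |k 1| then (1 : ℝ) else 0) *
      ‖mFourierCoeff (fun x => (a 2 x : ℂ)) k‖ ^ 2 ≤ jO) :
    ∑' k : Fin 2 → ℤ, (if |k 0| < ((800 : ℕ) : ℤ) then (1 : ℝ) else 0) * ‖mFourierCoeff (fun x => (a 2 x : ℂ)) k‖ ^ 2 +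
        ∑' k : Fin 2 → ℤ, (if ((800 : ℕ) : ℤ) ≤ |k 0| ∧ ((1 : ℕ) : ℤ) * |k 0| ≤ ((4 : ℕ) : ℤ) * |k 1| then (1 : ℝ) else 0) *
          ‖mFourierCoeff (fun x => (a 2 x : ℂ)) k‖ ^ 2 ≤
      171 / 20000 + jH + jV + jO := by
  have hstrip := phaseOne_strip12_le P hγ hN₀ hδ₀ hδ₀' hd a b h0 (hb 0) (hab 0)
  set X := ∑' k : Fin 2 → ℤ, (if |k 0| < ((800 : ℕ) : ℤ) then (1 : ℝ) else 0) * ‖mFourierCoeff (fun x => (a 2 x : ℂ)) k‖ ^ 2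
    with hX
  set Y := ∑' k : Fin 2 → ℤ, (if ((800 : ℕ) : ℤ) ≤ |k 0| ∧ ((1 : ℕ) : ℤ) * |k 0| ≤ ((4 : ℕ) : ℤ) * |k 1| then (1 : ℝ) else 0) *
      ‖mFourierCoeff (fun x => (a 2 x : ℂ)) k‖ ^ 2 with hY
  set T := ∑' k : Fin 2 → ℤ, (if |k 1| < (K' : ℤ) then (1 : ℝ) else 0) * ‖mFourierCoeff (fun x => (b 1 x : ℂ)) k‖ ^ 2 with hT'
  set S := ∑' k : Fin 2 → ℤ, (if |k 0| < ((12 : ℕ) : ℤ) then (1 : ℝ) else 0) * ‖mFourierCoeff (fun x => (a 1 x : ℂ)) k‖ ^ 2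
    with hS'
  have e1 : X + Y ≤ (T + jV) + jO := add_le_add hS hO
  have e2 : T ≤ S + jH := hT
  have e3 : S ≤ 171 / 20000 := hstrip
  linarith

end Cascade

end Summit.AnomalousDissipation.AnomalousDissipation.Theorems.SawtoothPulseCascade.K1Start
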